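import Literature.AlgebraicGeometry.Hu2025.Proofs.S04ModelV.GoverningBinomials
import HarnessLib

/-!
# Hu 2025 row 105 — Def. 4.49 «equivalently», block-own reading (kernel; D-lane): `Def4_49_equiv_ours` holds for every nontrivial
# coefficient ring and every model datum in which (H1) the chart monomial of each leading term is a single ϖ-variable `x_{u_F}` and
# (H2, within the block) `u_F` divides the chart monomial of no other term of `F̄`

Both hypotheses are platform facts of `Gr^{3,E}` (row 101a's `primaryTerms`: the leading term is `x_u · x̄_m = x_u`, and `u` occurs in
no other term of `F̄_{(123),u}`); (H2) is stated WITHIN the block — across blocks it fails at the platform (`x_{1bc}` divides the chart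
monomial of the term `p_{23a} p_{1bc}` of `F̄_{(123),(abc)}`), which is exactly where the free-`F′` AS-PRINTED rendering
`Def4_49_equiv` and the block-own `Def4_49_equiv_ours` part ways. Bookkeeping on rows 103/105 definitions. AI-written; weaker than expert review.
-/

noncomputable section

namespace Literature.AlgebraicGeometry.Hu2025.Proofs.S04ModelV

open MvPolynomial Literature.AlgebraicGeometry.Hu2025.Statements.S04ModelV

universe u v w x

variable {k : Type u} [CommRing k] {σ : Type v} {T : Type w} {𝔗 : Type x}

/-- Value of the exponent of `x̄_a · x_{(b)}` at a ϖ-index: the chart monomial of `a`. [cite: Hu2025, §4.5 Def. 4.49 ‹chunk 4.48› / (4.8), chunks p0031 l.165–166 / p0022 l.10–21 (unrefereed preprint arXiv:2507.21400v1 under adjudication, D-0012/D-0089 — kernel support on OUR typed carriers of rows 103/105; nothing of the source asserted)] -/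
theorem wpExp_inl (mono : T → (σ →₀ ℕ)) (a b : T) (s : σ) : (((mono a).mapDomain Sum.inl + Finsupp.single (Sum.inr b) 1 : σ ⊕ T →₀ ℕ)) (Sum.inl s) = mono a s := by
  simp only [Finsupp.coe_add, Pi.add_apply]
  rw [Finsupp.mapDomain_apply Sum.inl_injective, Finsupp.single_eq_of_ne (by simp), add_zero]

/-- **The ϖ-variables of a ℘-binomial**: for distinct terms `s ≠ t` over a nontrivial ring, `x_r` occurs in
`x̄_t x_{(s)} − x̄_s x_{(t)}` iff `x_r` divides `x̄_s` or `x̄_t`. [cite: Hu2025, §4.5 Def. 4.49 ‹chunk 4.48› / (4.8), chunks p0031 l.165–166 / p0022 l.10–21 (unrefereed preprint arXiv:2507.21400v1 under adjudication, D-0012/D-0089 — kernel support on OUR typed carriers of rows 103/105; nothing of the source asserted)] -/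
theorem inl_mem_vars_wpBinomial_iff [Nontrivial k] (mono : T → (σ →₀ ℕ)) {s t : T} (hst : s ≠ t) (r : σ) :
    (Sum.inl r : σ ⊕ T) ∈ (wpBinomial (k := k) mono s t).vars ↔ r ∈ (mono s).support ∨ r ∈ (mono t).support := by
  rw [mem_vars_iff_mem_support]
  constructor
  · rintro ⟨d, hd, hr⟩
    rw [mem_support_wpBinomial_iff mono hst] at hd
    rw [Finsupp.mem_support_iff] at hr
    rcases hd with rfl | rfl
    · rw [wpExp_inl] at hr; exact Or.inr (Finsupp.mem_support_iff.mpr hr)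
    · rw [wpExp_inl] at hr; exact Or.inl (Finsupp.mem_support_iff.mpr hr)
  · rintro (hr | hr)
    · exact ⟨(((mono s).mapDomain Sum.inl + Finsupp.single (Sum.inr t) 1 : σ ⊕ T →₀ ℕ)), (mem_support_wpBinomial_iff mono hst _).mpr (Or.inr rfl),
        by rw [Finsupp.mem_support_iff, wpExp_inl]; exact Finsupp.mem_support_iff.mp hr⟩
    · exact ⟨(((mono t).mapDomain Sum.inl + Finsupp.single (Sum.inr s) 1 : σ ⊕ T →₀ ℕ)), (mem_support_wpBinomial_iff mono hst _).mpr (Or.inl rfl),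
        by rw [Finsupp.mem_support_iff, wpExp_inl]; exact Finsupp.mem_support_iff.mp hr⟩

/-- **`Def4_49_equiv_ours` holds** under the two platform facts (H1) `x̄_{head F} = x_{u_F}` is a single variable and (H2, within the
block) `u_F` divides the chart monomial of no other term of `F̄`. [cite: Hu2025, §4.5 Def. 4.49 ‹chunk 4.48› / (4.8), chunks p0031 l.165–166 / p0022 l.10–21 (unrefereed preprint arXiv:2507.21400v1 under adjudication, D-0012/D-0089 — kernel support on OUR typed carriers of rows 103/105; nothing of the source asserted)] -/
theorem def4_49_equiv_ours_of_leading [Nontrivial k] (rel : T → 𝔗) (mono : T → (σ →₀ ℕ)) (head : 𝔗 → T)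
    (H1 : ∀ F : 𝔗, ∃ s : σ, mono (head F) = Finsupp.single s 1)
    (H2 : ∀ (F : 𝔗) (t : T), rel t = F → t ≠ head F → ∀ s : σ, mono (head F) = Finsupp.single s 1 → s ∉ (mono t).support) :
    Def4_49_equiv_ours (k := k) (σ := σ) rel mono head := by
  intro F f hf
  obtain ⟨a, b, hab, hne, haF, rfl, -⟩ := hf
  have haF' : rel a = F := by simpa using haF
  have hbF' : rel b = F := hab ▸ haF'
  rw [inr_mem_vars_wpBinomial_iff mono hne]
  constructor
  · -- the leading ϱ-variable occurs ⇒ `head F ∈ {a, b}` ⇒ `x_{u_F}` divides `x̄_{head F}`, which occurs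
    intro h
    obtain ⟨s, hs⟩ := H1 F
    refine ⟨s, hs, (inl_mem_vars_wpBinomial_iff mono hne s).mpr ?_⟩
    have hsupp : s ∈ (mono (head F)).support := by rw [hs]; simp
    rcases h with rfl | rfl
    · exact Or.inl hsupp
    · exact Or.inr hsupp
  · -- `x_{u_F}` occurs ⇒ it divides `x̄_a` or `x̄_b` ⇒ (H2) that term is the leading one
    rintro ⟨s, hs, hvar⟩
    rw [inl_mem_vars_wpBinomial_iff mono hne] at hvar
    rcases hvar with h | h
    · by_contra hcon
      push Not at hcon
      exact H2 F a haF' (Ne.symm hcon.1) s hs h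
    · by_contra hcon
      push Not at hcon
      exact H2 F b hbF' (Ne.symm hcon.2) s hs h

end Literature.AlgebraicGeometry.Hu2025.Proofs.S04ModelV

end
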